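import Summits.QuantumFields.QCD.Theses.HeatSlicedQuarks
import Summits.QuantumFields.QCD.Theorems.HeatSlicedQuarksDaviesGaffneyWilsonSemigroup
import Summits.QuantumFields.QCD.Theorems.HeatSlicedQuarksAccretiveWilsonDirac

/-!
# Stub `stub_heavyTailSliceBound` of line `Sketch`
(crux `Summit.QuantumFields.QCD.Theses.HeatSlicedQuarks.InterleavedFlowProper`,
item stmt-QuantumFields-18031)

**Massive last slice, U-uniform.**  For every torus side `L`, every `SU(3)` link field `U`, every
POSITIVE bare mass `m`, all `t ≥ 0` and all colour–spin entries,

  `‖e^{−t H_U}((x,a,α),(y,b,β))‖ ≤ e^{−t m²}`,  `H_U = D_W(U,m,1)ᴴ D_W(U,m,1)`,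

the matrix exponential being Mathlib's `NormedSpace.exp (-(t : ℂ) • H_U)`.

Proof.  By Wilson-term accretivity (tree `AccretiveWilsonDirac`, proved:
`accretiveWilsonDirac_proof`), `Re⟨v, D_W v⟩ = m‖v‖² + ½ Σ ‖…‖² ≥ m‖v‖²` for every colour–spin
field `v`.  Completing the square,
`0 ≤ ‖D_W v − m v‖² = ‖D_W v‖² − 2m Re⟨v, D_W v⟩ + m²‖v‖² ≤ ‖D_W v‖² − m²‖v‖²`,
so `Re⟨v, H_U v⟩ = ‖D_W v‖² ≥ m² ‖v‖²`, i.e. the numerical range of `H_U` lies in `[m², ∞)`,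
uniformly in `U`.  The matrix Lumer–Phillips bound of the tree
(`HeatSlicedQuarksDaviesGaffney.opNorm_toEuclideanCLM_exp_le`, with `ω = −m²`) gives
`‖e^{−t H_U}‖_{ℓ² → ℓ²} ≤ e^{−m² t}`, and every entry is bounded by the `ℓ²` operator norm
(`norm_entry_le_opNorm_toEuclideanCLM`).
No named facts are used (tree theorems + Mathlib only).
-/

namespace Summit.QuantumFields.QCD.Cruxes.InterleavedFlowProper.OffsetLastFormatHandover

open Literature.MathematicalPhysics.QuantumFieldTheory Literature.MathematicalPhysics.QuantumLattice
open Literature.Probability.LatticeModels (TorusSite)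
open Summit.QuantumFields.QCD.Theorems.HeatSlicedQuarksDaviesGaffney
  (opNorm_toEuclideanCLM_exp_le norm_entry_le_opNorm_toEuclideanCLM)
open Summit.QuantumFields.QCD.Theorems.HeatSlicedQuarksAccretiveWilsonDirac
  (accretiveWilsonDirac_proof)
open Matrix

/-- Completing the square, termwise: `‖w − m z‖² = ‖w‖² − 2m Re(z̄ w) + m² ‖z‖²` for complex `w, z`
and real `m`. -/
private theorem heavyTail_norm_sub_ofReal_mul_sq (m : ℝ) (w z : ℂ) :
    ‖w - (m : ℂ) * z‖ ^ 2 = ‖w‖ ^ 2 - 2 * m * (star z * w).re + m ^ 2 * ‖z‖ ^ 2 := by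
  rw [Complex.sq_norm, Complex.sq_norm, Complex.sq_norm, Complex.normSq_apply, Complex.normSq_apply,
    Complex.normSq_apply]
  simp only [Complex.sub_re, Complex.sub_im, Complex.mul_re, Complex.mul_im, Complex.ofReal_re,
    Complex.ofReal_im, Complex.star_def, Complex.conj_re, Complex.conj_im]
  ring

/-- From accretivity to coercivity of the square: if `m Σ_i ‖z_i‖² ≤ Re Σ_i z̄_i w_i` with `m > 0`,
then `m² Σ_i ‖z_i‖² ≤ Σ_i ‖w_i‖²` (complete the square: `0 ≤ Σ_i ‖w_i − m z_i‖²`). -/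
private theorem heavyTail_sq_sum_le_of_re_ge {n : Type*} [Fintype n] {m : ℝ} (hm : 0 < m)
    (z w : n → ℂ) (hacc : m * ∑ i, ‖z i‖ ^ 2 ≤ (∑ i, star (z i) * w i).re) :
    m ^ 2 * ∑ i, ‖z i‖ ^ 2 ≤ ∑ i, ‖w i‖ ^ 2 := by
  have hsq : 0 ≤ ∑ i, ‖w i - (m : ℂ) * z i‖ ^ 2 := Finset.sum_nonneg fun _ _ => by positivity
  have hexp : ∑ i, ‖w i - (m : ℂ) * z i‖ ^ 2 =
      ∑ i, ‖w i‖ ^ 2 - 2 * m * (∑ i, star (z i) * w i).re + m ^ 2 * ∑ i, ‖z i‖ ^ 2 := by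
    simp_rw [heavyTail_norm_sub_ofReal_mul_sq]
    rw [Finset.sum_add_distrib, Finset.sum_sub_distrib, Complex.re_sum, Finset.mul_sum,
      Finset.mul_sum]
  rw [hexp] at hsq
  nlinarith [mul_le_mul_of_nonneg_left hacc hm.le]

/-- `Re⟨v, Dᴴ D v⟩ = Σ_i ‖(D v)_i‖²`. -/
private theorem heavyTail_re_quadForm_conjTranspose_mul_self {n : Type*} [Fintype n]
    (D : Matrix n n ℂ) (v : n → ℂ) :
    (star v ⬝ᵥ (Dᴴ * D) *ᵥ v).re = ∑ i, ‖(D *ᵥ v) i‖ ^ 2 := by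
  rw [← mulVec_mulVec, dotProduct_mulVec, vecMul_conjTranspose, star_star, dotProduct,
    Complex.re_sum]
  refine Finset.sum_congr rfl fun i _ => ?_
  rw [Pi.star_apply, Complex.star_def, ← Complex.normSq_eq_conj_mul_self, Complex.ofReal_re,
    Complex.normSq_eq_norm_sq]

/-- **Coercivity of the massive Wilson–Dirac operator, U-uniform**: for `m > 0`,
`m² Σ_i ‖v_i‖² ≤ Σ_i ‖(D_W(U,m,1) v)_i‖²` for every `SU(3)` field `U` and every colour–spin
field `v` (accretivity `Re⟨v, D_W v⟩ ≥ m ‖v‖²` and completing the square). -/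
private theorem heavyTail_wilsonDirac_coercive {L : ℕ} [NeZero L]
    (U : GaugeConfig 4 L (Matrix.specialUnitaryGroup (Fin 3) ℂ)) {m : ℝ} (hm : 0 < m)
    (v : TorusSite 4 L × Fin 3 × Fin 4 → ℂ) :
    m ^ 2 * ∑ i, ‖v i‖ ^ 2 ≤ ∑ i, ‖(wilsonDirac (fundamentalRep (Fin 3)) U m 1 *ᵥ v) i‖ ^ 2 := by
  refine heavyTail_sq_sum_le_of_re_ge hm v _ ?_
  rw [accretiveWilsonDirac_proof L U m v]
  exact le_add_of_nonneg_right (by positivity)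

/-- **Massive last slice, U-uniform** (registered stub `stub_heavyTailSliceBound` of line `Sketch`):
for every `SU(3)` field `U`, every positive mass `m` and all `t ≥ 0`, every colour–spin entry of
`e^{−t H_U}`, `H_U = D_W(U,m,1)ᴴ D_W(U,m,1)`, is at most `e^{−t m²}`.  Accretivity `Re D_W ≥ m`
(`accretiveWilsonDirac_proof`) gives `H_U ≥ m²` as a quadratic form by completing the square, the
matrix Lumer–Phillips bound gives `‖e^{−t H_U}‖_{ℓ²→ℓ²} ≤ e^{−t m²}`, and entries are bounded by the
operator norm. -/
theorem stub_heavyTailSliceBound :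
    ∀ (L : ℕ) [NeZero L] (U : GaugeConfig 4 L (Matrix.specialUnitaryGroup (Fin 3) ℂ)) (m : ℝ), 0 < m →
      ∀ (t : ℝ), 0 ≤ t → ∀ (x y : Literature.Probability.LatticeModels.TorusSite 4 L) (a b : Fin 3) (α β : Fin 4),
        ‖(NormedSpace.exp (-(t : ℂ) • (Matrix.conjTranspose
            (wilsonDirac (fundamentalRep (Fin 3)) U m 1) * wilsonDirac (fundamentalRep (Fin 3)) U m 1)))
              (x, a, α) (y, b, β)‖ ≤ Real.exp (-(t * m ^ 2)) := by
  intro L _ U m hm t ht x y a b α β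
  -- numerical range of `H_U = D_Wᴴ D_W` lies in `[m², ∞)`, uniformly in `U`
  have hB : ∀ v : TorusSite 4 L × Fin 3 × Fin 4 → ℂ,
      -(-(m ^ 2) * ∑ i, ‖v i‖ ^ 2) ≤
        (star v ⬝ᵥ ((wilsonDirac (fundamentalRep (Fin 3)) U m 1)ᴴ *
          wilsonDirac (fundamentalRep (Fin 3)) U m 1) *ᵥ v).re := by
    intro v
    rw [neg_mul, neg_neg, heavyTail_re_quadForm_conjTranspose_mul_self]
    exact heavyTail_wilsonDirac_coercive U hm v
  -- Lumer–Phillips in the `ℓ²` operator norm, then entry ≤ operator norm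
  have hnorm := opNorm_toEuclideanCLM_exp_le _ hB ht
  refine ((norm_entry_le_opNorm_toEuclideanCLM _ _ _).trans hnorm).trans_eq ?_
  congr 1
  ring
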